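import Mathlib
import HarnessLib
import Summits.CriticalPhenomena.Ising3DConformalLimit.Theorems.PlantedPinningPinningEfficiencyDeficitOfSlack

/-!
# The exact slack decomposition of the pinning flow: `csq − pvar² = spatial + pattern + pin-set`
(route `PlantedPinning`, crux `PinningEfficiencyDeficit`, item stmt-CriticalPhenomena-8451: support for
the open stub S1 `stub_csSlackWindow` of the line `Cruxes/PinningEfficiencyDeficit/Lines/birth.lean`)

The registered stub S1 asks for a strict, `p`-uniform Cauchy–Schwarz/Jensen slack
`(1 + s)·(pvar L j)² ≤ csq L j` of the planted pinning flow; the slack-free direction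
`(pvar j)² ≤ csq j` is `pvar_sq_le_csq_abstract` (three lossy steps: Cauchy–Schwarz over the new pin,
Jensen over the planted pattern, Cauchy–Schwarz over the pin set).  Here the three losses are written
out EXACTLY, in the same abstract finite setting (positive probability weights `w` on patterns `ω`,
spins `s x ω`, agreement kernels `K P`, conditional expectations `E P` given the spins on `P`): with
`m = n − j`, `C_z = Cov(M, s_z | s|_P)`, `X = Var(M | s|_P) = ∑_{z ∉ P} C_z`, `a(P) = 𝔼_w X`,
`pvar = (n choose j)⁻¹ ∑_P a(P)`,

`csq j − (pvar j)² = (n choose j)⁻¹ ∑_{|P| = j} 𝔼_w[ m ∑_{z ∉ P} (C_z − X/m)² + (X − a(P))² ]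
                      + (n choose j)⁻¹ ∑_{|P| = j} (a(P) − pvar)²`                  (`csq_sub_pvar_sq_eq`)

— a SPATIAL variance of the local conditional susceptibility `z ↦ C_z` over the unpinned sites, a
PATTERN (planted-value) variance of the conditional variance `X`, and a PIN-SET variance of its
pattern average.  All three are sums of squares, which re-proves `pvar² ≤ csq` and shows that S1 is
exactly a `p`-uniform lower bound `spatial + pattern + pin-set ≥ s · pvar²`; in the thermodynamic
limit the last two are `O(L*(p)^d / n)` (self-averaging of `Var(M | pins)` over screening volumes),
so the load-bearing quantity is the spatial relative variance of `C_z` at the screening scale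
(line card `Lines/birth.md`, "First move for S1's prover").  Pure finite algebra; no definitions,
no named facts. [folklore]
-/

namespace Summit.CriticalPhenomena.Ising3DConformalLimit.PlantedPinningDeficit

open Finset
open Summit.CriticalPhenomena.Ising3DConformalLimit.PlantedPinningCeiling

/-! ### Three elementary variance identities -/

/-- Weighted variance identity: `∑ w (X − 𝔼_w X)² = 𝔼_w X² − (𝔼_w X)²` for probability weights.
[folklore] -/
theorem wsum_sq_sub_wmean_eq {Ω : Type*} [Fintype Ω] {w : Ω → ℝ} (hw1 : ∑ ω, w ω = 1)
    (X : Ω → ℝ) :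
    ∑ ω, w ω * (X ω - ∑ ω', w ω' * X ω') ^ 2 =
      ∑ ω, w ω * X ω ^ 2 - (∑ ω, w ω * X ω) ^ 2 := by
  set a : ℝ := ∑ ω', w ω' * X ω' with ha
  have h : ∀ ω, w ω * (X ω - a) ^ 2 = w ω * X ω ^ 2 - 2 * a * (w ω * X ω) + a ^ 2 * w ω :=
    fun ω => by ring
  simp_rw [h, Finset.sum_add_distrib, Finset.sum_sub_distrib, ← Finset.mul_sum, hw1]
  ring

/-- Unweighted variance identity over a nonempty finite index set:
`∑_{P ∈ S} (a P − (∑ a)/|S|)² = ∑ a² − (∑ a)²/|S|`. [folklore] -/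
theorem sum_sq_sub_avg_eq {ι : Type*} (S : Finset ι) (hS : S.card ≠ 0) (a : ι → ℝ) :
    ∑ P ∈ S, (a P - (∑ Q ∈ S, a Q) / (S.card : ℝ)) ^ 2 =
      ∑ P ∈ S, a P ^ 2 - (∑ Q ∈ S, a Q) ^ 2 / (S.card : ℝ) := by
  have hc : (S.card : ℝ) ≠ 0 := by exact_mod_cast hS
  set T : ℝ := ∑ Q ∈ S, a Q with hT
  have h : ∀ P, (a P - T / S.card) ^ 2 = a P ^ 2 - 2 * (T / S.card) * a P + (T / S.card) ^ 2 :=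
    fun P => by ring
  simp_rw [h, Finset.sum_add_distrib, Finset.sum_sub_distrib, ← Finset.mul_sum, Finset.sum_const,
    nsmul_eq_mul, ← hT]
  field_simp
  ring

/-- Spatial variance identity: if `∑_{z ∈ T} C z = X` and `|T| = m ≠ 0` then
`m ∑_{z ∈ T} (C z − X/m)² = m ∑_{z ∈ T} (C z)² − X²` (the Cauchy–Schwarz deficit as a variance).
[folklore] -/
theorem card_mul_sum_sq_sub_eq {ι : Type*} (T : Finset ι) {m : ℝ} (hm : (T.card : ℝ) = m)
    (hm0 : m ≠ 0) (C : ι → ℝ) {X : ℝ} (hX : ∑ z ∈ T, C z = X) :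
    m * ∑ z ∈ T, (C z - X / m) ^ 2 = m * ∑ z ∈ T, C z ^ 2 - X ^ 2 := by
  have h : ∀ z, (C z - X / m) ^ 2 = C z ^ 2 - 2 * (X / m) * C z + (X / m) ^ 2 := fun z => by ring
  simp_rw [h, Finset.sum_add_distrib, Finset.sum_sub_distrib, ← Finset.mul_sum, hX, Finset.sum_const,
    nsmul_eq_mul, hm]
  field_simp
  ring

/-! ### The decomposition -/

section Spins

variable {V Ω : Type*} [DecidableEq V] [Fintype Ω]

variable (w : Ω → ℝ) (s : V → Ω → ℝ) (Λ : Finset V)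
  {K : Finset V → Ω → Ω → ℝ} {E : Finset V → (Ω → ℝ) → Ω → ℝ}
  (hK1 : ∀ P a b, (∀ x ∈ P, s x a = s x b) → K P a b = 1)
  (hK0 : ∀ P a b, ¬ (∀ x ∈ P, s x a = s x b) → K P a b = 0)
  (hE : ∀ P f ω, E P f ω = (∑ ω', K P ω ω' * w ω' * f ω') / ∑ ω', K P ω ω' * w ω')

include hK1 hK0 hE in
/-- **Exact slack decomposition of the pinning flow** (abstract finite form).  With
`C_z(P,ω) = Cov(M, s_z | s|_P)(ω)`, `X(P,ω) = Var(M | s|_P)(ω)`, `a(P) = 𝔼_w X(P,·)`, `m = n − j`,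
`csq j = (n choose j)⁻¹ ∑_{|P|=j} 𝔼_w[m ∑_{z ∉ P} C_z²]` and `pvar j = (n choose j)⁻¹ ∑_{|P|=j} a(P)`:
`csq j − (pvar j)² = (n choose j)⁻¹ ∑_P 𝔼_w[m ∑_{z ∉ P}(C_z − X/m)² + (X − a(P))²]
 + (n choose j)⁻¹ ∑_P (a(P) − pvar j)²` for `j < n` — spatial variance of the local conditional
susceptibility, plus pattern variance of the conditional variance, plus pin-set variance of its
pattern mean (the three Cauchy–Schwarz/Jensen losses of Raghavendra–Tan 2012, Lemma 4.3, kept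
exactly). [folklore] -/
theorem csq_sub_pvar_sq_eq (hw : ∀ ω, 0 < w ω) (hw1 : ∑ ω, w ω = 1) (M : Ω → ℝ)
    (hM : ∀ ω, M ω = ∑ x ∈ Λ, s x ω) {j : ℕ} (hj : j < #Λ) :
    (∑ P ∈ Λ.powersetCard j, ∑ ω, w ω * (((#Λ : ℝ) - j) *
          ∑ z ∈ Λ \ P, (E P (fun ω => M ω * s z ω) ω - E P M ω * E P (s z) ω) ^ 2)) /
        ((#Λ).choose j : ℝ) -
      ((∑ P ∈ Λ.powersetCard j, ∑ ω, w ω * (E P (fun ω => M ω ^ 2) ω - (E P M ω) ^ 2)) /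
        ((#Λ).choose j : ℝ)) ^ 2 =
    (∑ P ∈ Λ.powersetCard j, ∑ ω, w ω *
        ((((#Λ : ℝ) - j) * ∑ z ∈ Λ \ P,
            (E P (fun ω => M ω * s z ω) ω - E P M ω * E P (s z) ω -
              (E P (fun ω => M ω ^ 2) ω - (E P M ω) ^ 2) / ((#Λ : ℝ) - j)) ^ 2) +
          ((E P (fun ω => M ω ^ 2) ω - (E P M ω) ^ 2) -
            ∑ ω', w ω' * (E P (fun ω => M ω ^ 2) ω' - (E P M ω') ^ 2)) ^ 2)) /
        ((#Λ).choose j : ℝ) +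
      (∑ P ∈ Λ.powersetCard j,
          ((∑ ω, w ω * (E P (fun ω => M ω ^ 2) ω - (E P M ω) ^ 2)) -
            (∑ Q ∈ Λ.powersetCard j, ∑ ω, w ω * (E Q (fun ω => M ω ^ 2) ω - (E Q M ω) ^ 2)) /
              ((#Λ).choose j : ℝ)) ^ 2) /
        ((#Λ).choose j : ℝ) := by
  set n := #Λ with hn
  set X : Finset V → Ω → ℝ := fun P ω => E P (fun ω => M ω ^ 2) ω - (E P M ω) ^ 2 with hX
  set Cz : Finset V → V → Ω → ℝ := fun P z ω =>
    E P (fun ω => M ω * s z ω) ω - E P M ω * E P (s z) ω with hCz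
  set a : Finset V → ℝ := fun P => ∑ ω, w ω * X P ω with ha
  set Cj : ℝ := (n.choose j : ℝ) with hCj
  set m : ℝ := (n : ℝ) - j with hm
  have hCpos : 0 < Cj := by rw [hCj]; exact_mod_cast Nat.choose_pos hj.le
  have hmpos : 0 < m := by
    have : (j : ℝ) + 1 ≤ n := by exact_mod_cast hj
    rw [hm]; linarith
  have hcardT : ∀ P ∈ Λ.powersetCard j, (#(Λ \ P) : ℝ) = m := by
    intro P hP
    obtain ⟨hPΛ, hPc⟩ := Finset.mem_powersetCard.1 hP
    rw [Finset.card_sdiff_of_subset hPΛ, hPc, Nat.cast_sub hj.le, hm]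
  have hcardS : (Λ.powersetCard j).card ≠ 0 := by
    rw [Finset.card_powersetCard]; exact (Nat.choose_pos hj.le).ne'
  have hcardS' : ((Λ.powersetCard j).card : ℝ) = Cj := by
    rw [Finset.card_powersetCard, hCj]
  -- (1) spatial: `m ∑_z (C_z − X/m)² = m ∑_z C_z² − X²` pointwise in `(P, ω)`
  have h1 : ∀ P ∈ Λ.powersetCard j, ∀ ω,
      m * ∑ z ∈ Λ \ P, (Cz P z ω - X P ω / m) ^ 2 = m * ∑ z ∈ Λ \ P, (Cz P z ω) ^ 2 - (X P ω) ^ 2 := by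
    intro P hP ω
    obtain ⟨hPΛ, _⟩ := Finset.mem_powersetCard.1 hP
    have hsumC : ∑ z ∈ Λ \ P, Cz P z ω = X P ω :=
      sum_condCov_eq_condVar w s Λ hK1 hK0 hE hw hPΛ hM ω
    exact card_mul_sum_sq_sub_eq (Λ \ P) (hcardT P hP) hmpos.ne' (fun z => Cz P z ω) hsumC
  -- (2) pattern: `∑ w (X − a)² = ∑ w X² − a²` for each `P`
  have h2 : ∀ P, ∑ ω, w ω * (X P ω - a P) ^ 2 = ∑ ω, w ω * (X P ω) ^ 2 - (a P) ^ 2 := by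
    intro P
    exact wsum_sq_sub_wmean_eq hw1 (X P)
  -- inner sum per `P`: `∑_ω w (m ∑ (C − X/m)² + (X − a)²) = ∑_ω w (m ∑ C²) − a²`
  have hinner : ∀ P ∈ Λ.powersetCard j,
      ∑ ω, w ω * (m * ∑ z ∈ Λ \ P, (Cz P z ω - X P ω / m) ^ 2 + (X P ω - a P) ^ 2) =
        ∑ ω, w ω * (m * ∑ z ∈ Λ \ P, (Cz P z ω) ^ 2) - (a P) ^ 2 := by
    intro P hP
    have hpt : ∀ ω, w ω * (m * ∑ z ∈ Λ \ P, (Cz P z ω - X P ω / m) ^ 2 + (X P ω - a P) ^ 2) =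
        w ω * (m * ∑ z ∈ Λ \ P, (Cz P z ω) ^ 2) - w ω * (X P ω) ^ 2 + w ω * (X P ω - a P) ^ 2 := by
      intro ω
      rw [h1 P hP ω]
      ring
    rw [Finset.sum_congr rfl fun ω _ => hpt ω, Finset.sum_add_distrib, Finset.sum_sub_distrib, h2 P]
    ring
  -- (3) pin-set: `∑_P (a − (∑ a)/Cj)² = ∑ a² − (∑ a)²/Cj`
  have h3 : ∑ P ∈ Λ.powersetCard j, (a P - (∑ Q ∈ Λ.powersetCard j, a Q) / Cj) ^ 2 =
      ∑ P ∈ Λ.powersetCard j, (a P) ^ 2 - (∑ Q ∈ Λ.powersetCard j, a Q) ^ 2 / Cj := by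
    have := sum_sq_sub_avg_eq (Λ.powersetCard j) hcardS a
    rw [hcardS'] at this
    exact this
  -- assemble
  have hsum1 : ∑ P ∈ Λ.powersetCard j,
      ∑ ω, w ω * (m * ∑ z ∈ Λ \ P, (Cz P z ω - X P ω / m) ^ 2 + (X P ω - a P) ^ 2) =
      ∑ P ∈ Λ.powersetCard j, ∑ ω, w ω * (m * ∑ z ∈ Λ \ P, (Cz P z ω) ^ 2) -
        ∑ P ∈ Λ.powersetCard j, (a P) ^ 2 := by
    rw [← Finset.sum_sub_distrib]
    exact Finset.sum_congr rfl hinner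
  change (∑ P ∈ Λ.powersetCard j, ∑ ω, w ω * (m * ∑ z ∈ Λ \ P, (Cz P z ω) ^ 2)) / Cj -
      ((∑ P ∈ Λ.powersetCard j, a P) / Cj) ^ 2 =
    (∑ P ∈ Λ.powersetCard j,
        ∑ ω, w ω * (m * ∑ z ∈ Λ \ P, (Cz P z ω - X P ω / m) ^ 2 + (X P ω - a P) ^ 2)) / Cj +
      (∑ P ∈ Λ.powersetCard j, (a P - (∑ Q ∈ Λ.powersetCard j, a Q) / Cj) ^ 2) / Cj
  rw [hsum1, h3]
  set B : ℝ := ∑ P ∈ Λ.powersetCard j, ∑ ω, w ω * (m * ∑ z ∈ Λ \ P, (Cz P z ω) ^ 2) with hB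
  set A : ℝ := ∑ P ∈ Λ.powersetCard j, a P with hA
  set A2 : ℝ := ∑ P ∈ Λ.powersetCard j, (a P) ^ 2 with hA2
  field_simp
  ring

include hK1 hK0 hE in
/-- **The spatial term alone bounds the slack from below**: for `j < n`,
`(n choose j)⁻¹ ∑_{|P|=j} 𝔼_w[(n − j) ∑_{z ∉ P} (C_z − X/(n−j))²] ≤ csq j − (pvar j)²`, i.e. a
`p`-uniform lower bound `spatial ≥ s · pvar²` already gives the stub S1 (`stub_csSlackWindow`).
[folklore] -/
theorem spatial_le_csq_sub_pvar_sq (hw : ∀ ω, 0 < w ω) (hw1 : ∑ ω, w ω = 1) (M : Ω → ℝ)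
    (hM : ∀ ω, M ω = ∑ x ∈ Λ, s x ω) {j : ℕ} (hj : j < #Λ) :
    (∑ P ∈ Λ.powersetCard j, ∑ ω, w ω *
        (((#Λ : ℝ) - j) * ∑ z ∈ Λ \ P,
            (E P (fun ω => M ω * s z ω) ω - E P M ω * E P (s z) ω -
              (E P (fun ω => M ω ^ 2) ω - (E P M ω) ^ 2) / ((#Λ : ℝ) - j)) ^ 2)) /
        ((#Λ).choose j : ℝ) ≤
    (∑ P ∈ Λ.powersetCard j, ∑ ω, w ω * (((#Λ : ℝ) - j) *
          ∑ z ∈ Λ \ P, (E P (fun ω => M ω * s z ω) ω - E P M ω * E P (s z) ω) ^ 2)) /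
        ((#Λ).choose j : ℝ) -
      ((∑ P ∈ Λ.powersetCard j, ∑ ω, w ω * (E P (fun ω => M ω ^ 2) ω - (E P M ω) ^ 2)) /
        ((#Λ).choose j : ℝ)) ^ 2 := by
  rw [csq_sub_pvar_sq_eq w s Λ hK1 hK0 hE hw hw1 M hM hj]
  have hCpos : (0 : ℝ) < ((#Λ).choose j : ℝ) := by exact_mod_cast Nat.choose_pos hj.le
  have hA : 0 ≤ (∑ P ∈ Λ.powersetCard j,
          ((∑ ω, w ω * (E P (fun ω => M ω ^ 2) ω - (E P M ω) ^ 2)) -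
            (∑ Q ∈ Λ.powersetCard j, ∑ ω, w ω * (E Q (fun ω => M ω ^ 2) ω - (E Q M ω) ^ 2)) /
              ((#Λ).choose j : ℝ)) ^ 2) / ((#Λ).choose j : ℝ) :=
    div_nonneg (Finset.sum_nonneg fun P _ => sq_nonneg _) hCpos.le
  have hB : (∑ P ∈ Λ.powersetCard j, ∑ ω, w ω *
        (((#Λ : ℝ) - j) * ∑ z ∈ Λ \ P,
            (E P (fun ω => M ω * s z ω) ω - E P M ω * E P (s z) ω -
              (E P (fun ω => M ω ^ 2) ω - (E P M ω) ^ 2) / ((#Λ : ℝ) - j)) ^ 2)) /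
        ((#Λ).choose j : ℝ) ≤
      (∑ P ∈ Λ.powersetCard j, ∑ ω, w ω *
        ((((#Λ : ℝ) - j) * ∑ z ∈ Λ \ P,
            (E P (fun ω => M ω * s z ω) ω - E P M ω * E P (s z) ω -
              (E P (fun ω => M ω ^ 2) ω - (E P M ω) ^ 2) / ((#Λ : ℝ) - j)) ^ 2) +
          ((E P (fun ω => M ω ^ 2) ω - (E P M ω) ^ 2) -
            ∑ ω', w ω' * (E P (fun ω => M ω ^ 2) ω' - (E P M ω') ^ 2)) ^ 2)) /
        ((#Λ).choose j : ℝ) := by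
    refine div_le_div_of_nonneg_right ?_ hCpos.le
    refine Finset.sum_le_sum fun P _ => Finset.sum_le_sum fun ω _ => ?_
    refine mul_le_mul_of_nonneg_left ?_ (hw ω).le
    linarith [sq_nonneg ((E P (fun ω => M ω ^ 2) ω - (E P M ω) ^ 2) -
            ∑ ω', w ω' * (E P (fun ω => M ω ^ 2) ω' - (E P M ω') ^ 2))]
  linarith

end Spins

/-! ### Registered form (binder-free header; the sub-goal registered on the crux item) -/

/-- **Exact slack decomposition, registered form** (all data and hypotheses universally quantified
so that the header is a single proposition; this is `csq_sub_pvar_sq_eq`). [folklore] -/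
theorem csq_sub_pvar_sq_eq_closed : ∀ (V Ω : Type*) [DecidableEq V] [Fintype Ω] (w : Ω → ℝ) (s : V → Ω → ℝ) (Λ : Finset V) (K : Finset V → Ω → Ω → ℝ) (E : Finset V → (Ω → ℝ) → Ω → ℝ), (∀ P a b, (∀ x ∈ P, s x a = s x b) → K P a b = 1) → (∀ P a b, ¬ (∀ x ∈ P, s x a = s x b) → K P a b = 0) → (∀ P f ω, E P f ω = (∑ ω', K P ω ω' * w ω' * f ω') / ∑ ω', K P ω ω' * w ω') → (∀ ω, 0 < w ω) → ∑ ω, w ω = 1 → ∀ (M : Ω → ℝ), (∀ ω, M ω = ∑ x ∈ Λ, s x ω) → ∀ j : ℕ, j < Λ.card → (∑ P ∈ Λ.powersetCard j, ∑ ω, w ω * (((Λ.card : ℝ) - j) * ∑ z ∈ Λ \ P, (E P (fun ω => M ω * s z ω) ω - E P M ω * E P (s z) ω) ^ 2)) / ((Λ.card).choose j : ℝ) - ((∑ P ∈ Λ.powersetCard j, ∑ ω, w ω * (E P (fun ω => M ω ^ 2) ω - (E P M ω) ^ 2)) / ((Λ.card).choose j : ℝ)) ^ 2 = (∑ P ∈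 Λ.powersetCard j, ∑ ω, w ω * ((((Λ.card : ℝ) - j) * ∑ z ∈ Λ \ P, (E P (fun ω => M ω * s z ω) ω - E P M ω * E P (s z) ω - (E P (fun ω => M ω ^ 2) ω - (E P M ω) ^ 2) / ((Λ.card : ℝ) - j)) ^ 2) + ((E P (fun ω => M ω ^ 2) ω - (E P M ω) ^ 2) - ∑ ω', w ω' * (E P (fun ω => M ω ^ 2) ω' - (E P M ω') ^ 2)) ^ 2)) / ((Λ.card).choose j : ℝ) + (∑ P ∈ Λ.powersetCard j, ((∑ ω, w ω * (E P (fun ω => M ω ^ 2) ω - (E P M ω) ^ 2)) - (∑ Q ∈ Λ.powersetCard j, ∑ ω, w ω * (E Q (fun ω => M ω ^ 2) ω - (E Q M ω) ^ 2)) / ((Λ.card).choose j : ℝ)) ^ 2) / ((Λ.card).choose j : ℝ) :=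
  fun _ _ _ _ w s Λ _ _ hK1 hK0 hE hw hw1 M hM _ hj =>
    csq_sub_pvar_sq_eq w s Λ hK1 hK0 hE hw hw1 M hM hj

end Summit.CriticalPhenomena.Ising3DConformalLimit.PlantedPinningDeficit
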